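import Mathlib
import Summits.ValiantsHypothesis.ValiantsHypothesis.Theorems.BarrierLeverPartitionMinorsHitByVPSimplexJoinBoxGameRectangleNoGo

/-!
# Route BarrierLever — item `PartitionMinorsHitByVP` (stmt-ValiantsHypothesis-19717), line `hidden_states`:
# THE DIMENSION LAW AT LEVEL TWO — no winning predicate holds at `r ≤ 1 + hd + C(hd,2)` columns containing a 2×2×2 sub-box

Helper file (`--supports stmt-ValiantsHypothesis-19717`; cell valiant-natproofs, rung V4, 𝒟-side door (c), line
`Cruxes/PartitionMinorsHitByVP/Lines/hidden_states.lean` v8, registered stub `stub_simplexPairLower`; prover seat val-np-p3 gen 14).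
Definition-free. Closes NO item; a NECESSARY CONDITION on every box-game winning predicate `W` (p647518 interface), one level above p658056.

THE POINT (memo val-np-p3 g14 §1/§6). The exact census says a 3-dimensional binary box needs total volume `> B₂(n) = 1 + n + C(n,2)`
(`v*(n,(2,2,2)) = B₂(n) + 1`). Kernel form (`not_boxWinning_cube`): for every `W` with the box-game hypothesis, every `hd ≥ 1`, every
`r ≤ 1 + hd + C(hd,2)` and every position `e` containing a COMBINATORIAL CUBE — eight distinct indices `i a b c` of one piece whose value in each
slot depends on one coordinate only — `¬ W hd r e`. Proof = the ball chain of the census: if `r ≤ hd+1` the cube contains a rectangle and p658056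
applies; if `hd+2 ≤ r ≤ 2hd` demand `(hd, r−hd)`, if `2hd+1 ≤ r` demand `(r−hd, hd)` (both legal); a one-slot colouring colours the cube in slices,
so a `true` cube column drags a whole 2×2 face into the small child, which has `≤ (hd−1)+1` columns — impossible by p658056; hence the cube
survives in `e ∘ g₀`, at `(hd−1, hd)` (rectangle, p658056) or at `(hd−1, r−hd)` with `r − hd ≤ 1 + (hd−1) + C(hd−1,2)` (Pascal) — induction on `r`.

WHAT THIS IS NOT: no statement about which designs win; item 19717 and `Stmt.simplexPairLower` stay OPEN; nothing on crux 14610 or VP ≠ VNP.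
-/

set_option linter.dupNamespace false

namespace Summit.ValiantsHypothesis.ValiantsHypothesis.Theorems.BarrierLever.SimplexJoin.Cut

open Finset

noncomputable section

variable {m D N : ℕ}

/-- `1 + n + C(n,2) ≤ 2^n` (the first three binomial coefficients). -/
theorem one_add_add_choose_two_le_two_pow (n : ℕ) : 1 + n + n.choose 2 ≤ 2 ^ n := by
  induction n with
  | zero => simp
  | succ n ih =>
    have h1 : n + 1 ≤ 2 ^ n := Nat.lt_two_pow_self
    have h2 : (n + 1).choose 2 = n + n.choose 2 := by
      rw [Nat.choose_succ_succ, Nat.choose_one_right]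
    rw [h2, pow_succ]
    omega

/-- **No box-game winning predicate holds below the radius-2 ball at a position containing a 2×2×2 sub-box** (crude floor). -/
theorem not_boxWinning_cube (W : (hd : ℕ) → (r : ℕ) → (Fin r → Fin m × (Fin D → Option (Fin N))) → Prop)
    (hwin : ∀ (hd r : ℕ) (e : Fin r → Fin m × (Fin D → Option (Fin N))), W hd r e → 2 ≤ r → 1 ≤ hd →
      ∀ r₀ r₁ : ℕ, r₀ + r₁ = r → (r - 2) / hd + 1 ≤ r₁ → r₁ ≤ r₀ → r₀ ≤ 2 ^ (hd - 1) →
        ∃ (f : Fin m → Fin D) (side : Fin m → Option (Fin N) → Bool) (g₀ : Fin r₀ → Fin r) (g₁ : Fin r₁ → Fin r),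
          Function.Injective (Sum.elim g₀ g₁) ∧
          (∀ j, side (e (g₀ j)).1 ((e (g₀ j)).2 (f (e (g₀ j)).1)) = false) ∧
          (∀ j, side (e (g₁ j)).1 ((e (g₁ j)).2 (f (e (g₁ j)).1)) = true) ∧
          W (hd - 1) r₀ (fun j => e (g₀ j)) ∧ W (hd - 1) r₁ (fun j => e (g₁ j))) :
    ∀ (r hd : ℕ) (e : Fin r → Fin m × (Fin D → Option (Fin N))) (i : Fin 2 → Fin 2 → Fin 2 → Fin r),
      1 ≤ hd → r ≤ 1 + hd + hd.choose 2 →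
      (∀ a b c a' b' c', i a b c = i a' b' c' → a = a' ∧ b = b' ∧ c = c') →
      (∀ a b c, (e (i a b c)).1 = (e (i 0 0 0)).1) →
      (∀ φ : Fin D, (∀ a b c, (e (i a b c)).2 φ = (e (i a 0 0)).2 φ) ∨ (∀ a b c, (e (i a b c)).2 φ = (e (i 0 b 0)).2 φ) ∨
        (∀ a b c, (e (i a b c)).2 φ = (e (i 0 0 c)).2 φ)) →
      ¬ W hd r e := by
  intro r
  induction r using Nat.strong_induction_on with
  | _ r IH =>
  intro hd e i hhd hr hinj hpiece hcube hW
  classical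
  -- the face `c = 0` is a rectangle (used twice)
  have hrectface : ∀ {r' : ℕ} (e' : Fin r' → Fin m × (Fin D → Option (Fin N))) (i' : Fin 2 → Fin 2 → Fin 2 → Fin r'),
      (∀ a b c, (e' (i' a b c)).1 = (e' (i' 0 0 0)).1) →
      (∀ φ : Fin D, (∀ a b c, (e' (i' a b c)).2 φ = (e' (i' a 0 0)).2 φ) ∨ (∀ a b c, (e' (i' a b c)).2 φ = (e' (i' 0 b 0)).2 φ) ∨
        (∀ a b c, (e' (i' a b c)).2 φ = (e' (i' 0 0 c)).2 φ)) →
      (∀ a b, (e' (i' a b 0)).1 = (e' (i' 0 0 0)).1) ∧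
      (∀ φ : Fin D, (∀ a b, (e' (i' a b 0)).2 φ = (e' (i' a 0 0)).2 φ) ∨ (∀ a b, (e' (i' a b 0)).2 φ = (e' (i' 0 b 0)).2 φ)) := by
    intro r' e' i' hp hc
    refine ⟨fun a b => hp a b 0, fun φ => ?_⟩
    rcases hc φ with h | h | h
    · exact Or.inl fun a b => h a b 0
    · exact Or.inr fun a b => h a b 0
    · exact Or.inl fun a b => by rw [h a b 0, h a 0 0]
  -- eight distinct indices force `8 ≤ r`
  have hcard : 8 ≤ r := by
    have hi : Function.Injective (fun abc : Fin 2 × Fin 2 × Fin 2 => i abc.1 abc.2.1 abc.2.2) := by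
      rintro ⟨a, b, c⟩ ⟨a', b', c'⟩ h
      obtain ⟨ha, hb, hc⟩ := hinj a b c a' b' c' h
      simp [ha, hb, hc]
    have := Fintype.card_le_of_injective _ hi
    simpa [Fintype.card_fin, Fintype.card_prod] using this
  -- Case A: `r ≤ hd + 1` — the face is a rectangle in a short position
  by_cases hA : r ≤ hd + 1
  · obtain ⟨hp', hr'⟩ := hrectface e i hpiece hcube
    exact not_boxWinning_rect W hwin r hd e (fun a b => i a b 0) hA
      (fun a b a' b' h => let t := hinj a b 0 a' b' 0 h; ⟨t.1, t.2.1⟩) hp' hr' hW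
  push Not at hA
  -- the demand: `(hd, r − hd)` if `r ≤ 2hd`, `(r − hd, hd)` otherwise
  have h2r : 2 ≤ r := by omega
  have hpowhd : hd ≤ 2 ^ (hd - 1) := by
    have key : ∀ n : ℕ, n + 1 ≤ 2 ^ n := fun n => Nat.lt_two_pow_self
    rcases Nat.exists_eq_add_of_le hhd with ⟨k, rfl⟩
    simpa [Nat.add_sub_cancel_left, add_comm] using key k
  have hpasc : hd.choose 2 = (hd - 1) + (hd - 1).choose 2 := by
    rcases Nat.exists_eq_add_of_le hhd with ⟨k, rfl⟩
    simp [add_comm, Nat.choose_succ_succ, Nat.choose_one_right]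
  have hpow2 : 1 + hd.choose 2 ≤ 2 ^ (hd - 1) := by
    have := one_add_add_choose_two_le_two_pow (hd - 1)
    omega
  -- choose r₀, r₁
  obtain ⟨r₀, r₁, hsum, hfl, h10, hpw, hr₀le, hr₁le, hcase⟩ :
      ∃ r₀ r₁ : ℕ, r₀ + r₁ = r ∧ (r - 2) / hd + 1 ≤ r₁ ∧ r₁ ≤ r₀ ∧ r₀ ≤ 2 ^ (hd - 1) ∧
        r₀ ≤ (hd - 1) + 1 + ((hd - 1).choose 2) ∧ r₁ ≤ (hd - 1) + 1 ∧ (r₀ ≤ (hd - 1) + 1 ∨ r₀ < r) := by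
    by_cases hB : r ≤ 2 * hd
    · refine ⟨hd, r - hd, by omega, ?_, by omega, hpowhd, by omega, by omega, Or.inl (by omega)⟩
      have : (r - 2) / hd ≤ 1 := by
        apply Nat.le_of_lt_succ
        exact Nat.div_lt_of_lt_mul (by omega)
      omega
    · push Not at hB
      refine ⟨r - hd, hd, by omega, ?_, by omega, by omega, by omega, by omega, Or.inr (by omega)⟩
      have hc2 : hd.choose 2 ≤ hd * (hd - 1) := by
        rw [Nat.choose_two_right]; exact Nat.div_le_self _ _
      have hmul : hd * (hd - 1) + hd = hd * hd := by
        rcases Nat.exists_eq_add_of_le hhd with ⟨k, rfl⟩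
        simp; ring
      have key : r - 2 < hd * hd := by
        have h := hmul; have h' := hc2
        generalize hd * (hd - 1) = X at h h'
        generalize hd * hd = Y at h ⊢
        omega
      have : (r - 2) / hd < hd := Nat.div_lt_of_lt_mul key
      omega
  obtain ⟨f, side, g₀, g₁, hg, hfalse, htrue, hW0, hW1⟩ := hwin hd r e hW h2r hhd r₀ r₁ hsum hfl h10 hpw
  set col : Fin r → Bool := fun k => side (e k).1 ((e k).2 (f (e k).1)) with hcol
  have hsurj : Function.Surjective (Sum.elim g₀ g₁) := by
    have hbij := (Fintype.bijective_iff_injective_and_card _).mpr ⟨hg, by simp [Fintype.card_sum, Fintype.card_fin]; omega⟩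
    exact hbij.2
  have hpre1 : ∀ k, col k = true → ∃ j, g₁ j = k := by
    intro k hk
    obtain ⟨s, hs⟩ := hsurj k
    rcases s with j | j
    · have : col k = false := by rw [← hs]; exact hfalse j
      rw [hk] at this; exact absurd this (by decide)
    · exact ⟨j, hs⟩
  have hpre0 : ∀ k, col k = false → ∃ j, g₀ j = k := by
    intro k hk
    obtain ⟨s, hs⟩ := hsurj k
    rcases s with j | j
    · exact ⟨j, hs⟩
    · have : col k = true := by rw [← hs]; exact htrue j
      rw [hk] at this; exact absurd this (by decide)
  -- a rectangle inside the small child is impossible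
  have hnoRect1 : ∀ (j : Fin 2 → Fin 2 → Fin r₁), (∀ a b a' b', j a b = j a' b' → a = a' ∧ b = b') →
      (∀ a b, (e (g₁ (j a b))).1 = (e (g₁ (j 0 0))).1) →
      (∀ φ : Fin D, (∀ a b, (e (g₁ (j a b))).2 φ = (e (g₁ (j a 0))).2 φ) ∨
        (∀ a b, (e (g₁ (j a b))).2 φ = (e (g₁ (j 0 b))).2 φ)) → False := by
    intro j hjinj hjp hjr
    exact not_boxWinning_rect W hwin r₁ (hd - 1) (fun k => e (g₁ k)) j hr₁le hjinj hjp hjr hW1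
  -- colours on the cube: constant along two of the three coordinates
  have hp : ∀ a b c, (e (i a b c)).1 = (e (i 0 0 0)).1 := hpiece
  -- STEP 1: no cube column is `true`
  have hallfalse : ∀ a b c, col (i a b c) = false := by
    by_contra hex
    push Not at hex
    obtain ⟨a₀, b₀, c₀, htr⟩ := hex
    have htr' : col (i a₀ b₀ c₀) = true := by simpa using htr
    rcases hcube (f (e (i 0 0 0)).1) with hdep | hdep | hdep
    · -- depends on `a`: the face `a = a₀` is all true
      have hface : ∀ b c, col (i a₀ b c) = true := by
        intro b c
        have : col (i a₀ b c) = col (i a₀ b₀ c₀) := by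
          simp only [hcol, hp a₀ b c, hp a₀ b₀ c₀, hdep a₀ b c, hdep a₀ b₀ c₀]
        rw [this, htr']
      have hj : ∀ b c, ∃ j, g₁ j = i a₀ b c := fun b c => hpre1 _ (hface b c)
      choose j hj using hj
      refine hnoRect1 j (fun b c b' c' h => ?_) (fun b c => ?_) (fun φ => ?_)
      · have := hinj a₀ b c a₀ b' c' (by rw [← hj b c, ← hj b' c', h]); exact ⟨this.2.1, this.2.2⟩
      · simp only [hj]; rw [hp a₀ b c, hp a₀ 0 0]
      · simp only [hj]
        rcases hcube φ with h | h | h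
        · exact Or.inl fun b c => by rw [h a₀ b c, h a₀ b 0]
        · exact Or.inl fun b c => by rw [h a₀ b c, h a₀ b 0]
        · exact Or.inr fun b c => by rw [h a₀ b c, h a₀ 0 c]
    · -- depends on `b`: the face `b = b₀`
      have hface : ∀ a c, col (i a b₀ c) = true := by
        intro a c
        have : col (i a b₀ c) = col (i a₀ b₀ c₀) := by
          simp only [hcol, hp a b₀ c, hp a₀ b₀ c₀, hdep a b₀ c, hdep a₀ b₀ c₀]
        rw [this, htr']
      have hj : ∀ a c, ∃ j, g₁ j = i a b₀ c := fun a c => hpre1 _ (hface a c)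
      choose j hj using hj
      refine hnoRect1 j (fun a c a' c' h => ?_) (fun a c => ?_) (fun φ => ?_)
      · have := hinj a b₀ c a' b₀ c' (by rw [← hj a c, ← hj a' c', h]); exact ⟨this.1, this.2.2⟩
      · simp only [hj]; rw [hp a b₀ c, hp 0 b₀ 0]
      · simp only [hj]
        rcases hcube φ with h | h | h
        · exact Or.inl fun a c => by rw [h a b₀ c, h a b₀ 0]
        · exact Or.inl fun a c => by rw [h a b₀ c, h a b₀ 0]
        · exact Or.inr fun a c => by rw [h a b₀ c, h 0 b₀ c]
    · -- depends on `c`: the face `c = c₀`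
      have hface : ∀ a b, col (i a b c₀) = true := by
        intro a b
        have : col (i a b c₀) = col (i a₀ b₀ c₀) := by
          simp only [hcol, hp a b c₀, hp a₀ b₀ c₀, hdep a b c₀, hdep a₀ b₀ c₀]
        rw [this, htr']
      have hj : ∀ a b, ∃ j, g₁ j = i a b c₀ := fun a b => hpre1 _ (hface a b)
      choose j hj using hj
      refine hnoRect1 j (fun a b a' b' h => ?_) (fun a b => ?_) (fun φ => ?_)
      · have := hinj a b c₀ a' b' c₀ (by rw [← hj a b, ← hj a' b', h]); exact ⟨this.1, this.2.1⟩
      · simp only [hj]; rw [hp a b c₀, hp 0 0 c₀]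
      · simp only [hj]
        rcases hcube φ with h | h | h
        · exact Or.inl fun a b => by rw [h a b c₀, h a 0 c₀]
        · exact Or.inr fun a b => by rw [h a b c₀, h 0 b c₀]
        · exact Or.inl fun a b => by rw [h a b c₀, h a 0 c₀]
  -- STEP 2: the cube survives in `e ∘ g₀`
  have hj : ∀ a b c, ∃ j, g₀ j = i a b c := fun a b c => hpre0 _ (hallfalse a b c)
  choose j hj using hj
  have hjinj : ∀ a b c a' b' c', j a b c = j a' b' c' → a = a' ∧ b = b' ∧ c = c' :=
    fun a b c a' b' c' h => hinj a b c a' b' c' (by rw [← hj a b c, ← hj a' b' c', h])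
  have hjp : ∀ a b c, (e (g₀ (j a b c))).1 = (e (g₀ (j 0 0 0))).1 := fun a b c => by simp only [hj]; exact hp a b c
  have hjc : ∀ φ : Fin D, (∀ a b c, (e (g₀ (j a b c))).2 φ = (e (g₀ (j a 0 0))).2 φ) ∨
      (∀ a b c, (e (g₀ (j a b c))).2 φ = (e (g₀ (j 0 b 0))).2 φ) ∨ (∀ a b c, (e (g₀ (j a b c))).2 φ = (e (g₀ (j 0 0 c))).2 φ) := by
    intro φ; simp only [hj]; exact hcube φ
  rcases hcase with hshort | hlt
  · -- the big child is short: rectangle no-go on the face `c = 0`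
    obtain ⟨hp', hr'⟩ := hrectface (fun k => e (g₀ k)) j hjp hjc
    exact not_boxWinning_rect W hwin r₀ (hd - 1) (fun k => e (g₀ k)) (fun a b => j a b 0) hshort
      (fun a b a' b' h => let t := hjinj a b 0 a' b' 0 h; ⟨t.1, t.2.1⟩) hp' hr' hW0
  · -- induction
    have hhd1 : 1 ≤ hd - 1 := by
      -- r₀ ≥ r − hd ≥ hd + 1 ≥ 2 columns survive only if hd ≥ 2; in fact 8 ≤ r₀ forces it via r₀ ≤ (hd−1)+1+C(hd−1,2)
      by_contra h0
      have : hd = 1 := by omega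
      subst this
      simp at hr₀le
      have h8 : 8 ≤ r₀ := by
        have hi : Function.Injective (fun abc : Fin 2 × Fin 2 × Fin 2 => j abc.1 abc.2.1 abc.2.2) := by
          rintro ⟨a, b, c⟩ ⟨a', b', c'⟩ h
          obtain ⟨ha, hb, hc⟩ := hjinj a b c a' b' c' h
          simp [ha, hb, hc]
        have := Fintype.card_le_of_injective _ hi
        simpa [Fintype.card_fin, Fintype.card_prod] using this
      omega
    exact IH r₀ hlt (hd - 1) (fun k => e (g₀ k)) j hhd1 (by omega) hjinj hjp hjc hW0

end

end Summit.ValiantsHypothesis.ValiantsHypothesis.Theorems.BarrierLever.SimplexJoin.Cut
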